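import Summits.HodgeConjecture.HodgeConjecture.Theorems.HodgeLocusCensusPlaneSumCert
import HarnessLib

/-!
# HodgeLocusCensusJoinStackCert — Kronecker ("join") stacked core certificates for rank [M_{J(E,E′)} ; M_{J(E,L′)}] (cell pub-hlocus, LEAD gen 5, (T40))
HONEST FRAMING: certified instances and evidence bearing on the general Hodge conjecture; no claim.

The last two typed census rank rows, `DoubleBlock.stackRankJEE_JEL_{6,8}_4` (91 / 187), are STACKED ranks of two classes of FULLY head-twisted
planes plane64 a₁ a₃ a₅ a₇ (resp. plane84 a₁ a₃ a₅ a₇ 0): the join J(E,E′) (sixteen planes, (a₁,a₃), (a₅,a₇) ∈ E-lines) over the join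
J(E,L′) = `GrSection.fourPlanes` (four planes). With FOUR twisted head pairs the entry formula reads
entry(i,j) = [pair sums of i+j all 2] · ζ^{tails} · C(h₀,h₁,h₂,h₃), C the 4-head core `qcore`, so the stacked matrix is block diagonal in the type
with blocks the stacked 4-head core blocks [C¹_s ; C²_s], s ∈ {0,1,2}⁴. Because join periods MULTIPLY, both cores factor through the blocks:
C¹(h) = A(h₀,h₁) · B(h₂,h₃) and C²(h) = A(h₀,h₁) · Z(h₂,h₃) (A, B the 2-head cores of E, E′ and Z that of L′), so
[C¹_s ; C²_s] = A_{s′} ⊗ [B_{s″} ; Z_{s″}] (s = (s′,s″)) and an LU certificate of the 4-head stacked block is the KRONECKER PRODUCT of an LU certificate of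
A_{s′} (9 tiny matrices) with one of the stacked [B_{s″} ; Z_{s″}] (9 more). A `KronCert` stores the three 2-head classes (LA ; LB, LZ) and the two families of 2-head certificates;
its accessors `rs / rowP / colP / A / B / w` present the Kronecker product as a 4-head stacked certificate (mode ℓ = ℓ_A · r_B + ℓ_B, pivot rows and
columns paired accordingly). The Boolean `KronCert.valid L1 L2` — decided by the kernel in the class file, a few hundred products in ℤ[ζ₈] — states
(C) the 4-head cores of L1, L2 split as C¹ = A·B, C² = A·Z on all heads ≤ 2, and (F) (T) (P) for the two families of SMALL certificates; the
soundness theorems `factor_eq_eval / A_upper_zero / B_lower_zero / pivots` then establish (F) (T) (P) for the EXPANDED 4-head stacked certificate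
(the Kronecker product of LU certificates is an LU certificate: Σ_{ℓ<r_A r_B} splits as a double sum, lexicographic pairing preserves
triangularity, products of positive-integer pivots are positive integers), which `HodgeLocusCensusJoinStackRank{6,8}` turn into rank theorems.
-/

namespace Summit.HodgeConjecture.HodgeConjecture.HodgeLocus.Census.PlaneSum

open TwistCells GrSection

/-! ## The 4-head core of a signed sum of fully twisted planes -/

/-- C(a,b,c,d) = Σ_P c_P ζ^{(a+1)(1+2a₁)+(b+1)(1+2a₃)+(c+1)(1+2a₅)+(d+1)(1+2a₇)} for the class L = [(c_P, a₁, a₃, a₅, a₇)]. -/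
def qcore : List (ℤ × ℕ × ℕ × ℕ × ℕ) → ℕ → ℕ → ℕ → ℕ → Z8
  | [], _, _, _, _ => 0
  | p :: L, a, b, c, d => Z8.smul p.1 (Z8.mono ((a + 1) * (1 + 2 * p.2.1) + (b + 1) * (1 + 2 * p.2.2.1) + (c + 1) * (1 + 2 * p.2.2.2.1) +
      (d + 1) * (1 + 2 * p.2.2.2.2))) + qcore L a b c d

variable {K : Type*} [Field K] (ζ : K)

/-- eval of the 4-head core is the signed sum of the plane periods' head factors. -/
theorem eval_qcore (h4 : ζ ^ 4 = -1) (L : List (ℤ × ℕ × ℕ × ℕ × ℕ)) (a b c d : ℕ) : Z8.eval ζ (qcore L a b c d) =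
    (L.map fun p => (p.1 : K) * ζ ^ ((a + 1) * (1 + 2 * p.2.1) + (b + 1) * (1 + 2 * p.2.2.1) + (c + 1) * (1 + 2 * p.2.2.2.1) +
      (d + 1) * (1 + 2 * p.2.2.2.2))).sum := by
  induction L with
  | nil => simp [qcore, Z8.zero_def, Z8.eval_zero]
  | cons p L ih => rw [qcore, Z8.eval_add, Z8.eval_smul, Z8.eval_mono ζ h4, ih, List.map_cons, List.sum_cons]

/-- the class as a census δ on X⁴₆ (all four pairs twisted) … -/
def planeList6q (L : List (ℤ × ℕ × ℕ × ℕ × ℕ)) : List (ℚ × LinearCycle 6) :=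
  L.map fun p => ((p.1 : ℚ), plane64 p.2.1 p.2.2.1 p.2.2.2.1 p.2.2.2.2)
/-- … and on X⁴₈ (tail pair untwisted). -/
def planeList8q (L : List (ℤ × ℕ × ℕ × ℕ × ℕ)) : List (ℚ × LinearCycle 8) :=
  L.map fun p => ((p.1 : ℚ), plane84 p.2.1 p.2.2.1 p.2.2.2.1 p.2.2.2.2 0)

/-- ENTRY FORMULA on X⁴₆, four twisted pairs: p_i(δ) = [pair sums 2] · C(i₀, i₂, i₄, i₆)(ζ). -/
theorem periodComb_planeList6q (h4 : ζ ^ 4 = -1) (L : List (ℤ × ℕ × ℕ × ℕ × ℕ)) (i : Fin 8 → ℕ) :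
    periodComb 6 4 ζ (planeList6q L) i =
      if i 0 + i 1 = 2 ∧ i 2 + i 3 = 2 ∧ i 4 + i 5 = 2 ∧ i 6 + i 7 = 2 then Z8.eval ζ (qcore L (i 0) (i 2) (i 4) (i 6)) else 0 := by
  induction L with
  | nil => simp [periodComb, planeList6q, qcore, Z8.zero_def, Z8.eval_zero]
  | cons p L ih =>
    have hc : periodComb 6 4 ζ (planeList6q (p :: L)) i = ((p.1 : ℚ) : K) * period 6 4 ζ (plane64 p.2.1 p.2.2.1 p.2.2.2.1 p.2.2.2.2) i +
        periodComb 6 4 ζ (planeList6q L) i := by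
      simp [periodComb, planeList6q]
    rw [hc, ih, period_plane64, qcore, Z8.eval_add, Z8.eval_smul, Z8.eval_mono ζ h4, Rat.cast_intCast]
    split_ifs <;> ring

/-- ENTRY FORMULA on X⁴₈, four twisted pairs: p_i(δ) = [pair sums 2] · ζ^{i₈+1} · C(i₀, i₂, i₄, i₆)(ζ). -/
theorem periodComb_planeList8q (h4 : ζ ^ 4 = -1) (L : List (ℤ × ℕ × ℕ × ℕ × ℕ)) (i : Fin 10 → ℕ) :
    periodComb 8 4 ζ (planeList8q L) i =
      if i 0 + i 1 = 2 ∧ i 2 + i 3 = 2 ∧ i 4 + i 5 = 2 ∧ i 6 + i 7 = 2 ∧ i 8 + i 9 = 2 then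
        ζ ^ (i 8 + 1) * Z8.eval ζ (qcore L (i 0) (i 2) (i 4) (i 6)) else 0 := by
  induction L with
  | nil => simp [periodComb, planeList8q, qcore, Z8.zero_def, Z8.eval_zero]
  | cons p L ih =>
    have hc : periodComb 8 4 ζ (planeList8q (p :: L)) i = ((p.1 : ℚ) : K) * period 8 4 ζ (plane84 p.2.1 p.2.2.1 p.2.2.2.1 p.2.2.2.2 0) i +
        periodComb 8 4 ζ (planeList8q L) i := by
      simp [periodComb, planeList8q]
    rw [hc, ih, PlaneRank8.period_plane84, qcore, Z8.eval_add, Z8.eval_smul, Z8.eval_mono ζ h4, Rat.cast_intCast]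
    split_ifs <;> ring

/-- the 2-head core A(a,b) = Σ c ζ^{(a+1)(1+2t₁)+(b+1)(1+2t₂)} of one block's class [(c, t₁, t₂)]. -/
def hcore : List (ℤ × ℕ × ℕ) → ℕ → ℕ → Z8
  | [], _, _ => 0
  | p :: L, a, b => Z8.smul p.1 (Z8.mono ((a + 1) * (1 + 2 * p.2.1) + (b + 1) * (1 + 2 * p.2.2))) + hcore L a b

/-- the layer selector for one block's classes. -/
def hlayer (LB LZ : List (ℤ × ℕ × ℕ)) (lay : ℕ) : List (ℤ × ℕ × ℕ) := if lay = 0 then LB else LZ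

/-- the layer selector for 4-twist classes: layer 0 is the top class L1, any other layer index the bottom class L2. -/
def qlayer (L1 L2 : List (ℤ × ℕ × ℕ × ℕ × ℕ)) (lay : ℕ) : List (ℤ × ℕ × ℕ × ℕ × ℕ) := if lay = 0 then L1 else L2

/-- layer 0 of a 4-twist pair. -/
theorem qlayer_zero (L1 L2 : List (ℤ × ℕ × ℕ × ℕ × ℕ)) : qlayer L1 L2 0 = L1 := rfl
/-- layer 1 of a 4-twist pair. -/
theorem qlayer_one (L1 L2 : List (ℤ × ℕ × ℕ × ℕ × ℕ)) : qlayer L1 L2 1 = L2 := rfl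

/-! ## ℤ[ζ₈] bookkeeping for products of certificates -/

namespace Z8

/-- 0 · x = 0 in ℤ[ζ₈]. -/
theorem zero_mul' (x : Z8) : (0 : Z8) * x = 0 := by
  cases x
  simp [mul_def, mul, zero_def]

/-- x · 0 = 0 in ℤ[ζ₈]. -/
theorem mul_zero' (x : Z8) : x * (0 : Z8) = 0 := by
  cases x
  simp [mul_def, mul, zero_def]

/-- (x y)(z t) = (x z)(y t) in ℤ[ζ₈]. -/
theorem mul_mul_mul_comm' (x y z t : Z8) : x * y * (z * t) = x * z * (y * t) := by
  cases x; cases y; cases z; cases t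
  simp only [mul_def, mul, Z8.mk.injEq]
  refine ⟨?_, ?_, ?_, ?_⟩ <;> ring

/-- a product of positive integers is a positive integer. -/
theorem isPosConst_mul {x y : Z8} (hx : x.isPosConst = true) (hy : y.isPosConst = true) : (x * y).isPosConst = true := by
  rw [isPosConst_iff] at hx hy ⊢
  obtain ⟨hx0, hx1, hx2, hx3⟩ := hx
  obtain ⟨hy0, hy1, hy2, hy3⟩ := hy
  cases x; cases y
  simp only at hx0 hx1 hx2 hx3 hy0 hy1 hy2 hy3
  subst hx1 hx2 hx3 hy1 hy2 hy3
  simp only [mul_def, mul]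
  refine ⟨?_, by ring, by ring, by ring⟩
  nlinarith

end Z8

/-- Σ_{ℓ < p·q} F(ℓ / q) · G(ℓ % q) = (Σ_{i<p} F i) · (Σ_{j<q} G j): the mode sum of a Kronecker product splits. -/
theorem sum_range_mul_divMod {β : Type*} [CommSemiring β] (p q : ℕ) (F G : ℕ → β) :
    ∑ ℓ ∈ Finset.range (p * q), F (ℓ / q) * G (ℓ % q) = (∑ i ∈ Finset.range p, F i) * ∑ j ∈ Finset.range q, G j := by
  induction p with
  | zero => simp
  | succ p ih =>
    rcases Nat.eq_zero_or_pos q with hq | hq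
    · subst hq
      simp
    have key : ∑ x ∈ Finset.range q, F ((p * q + x) / q) * G ((p * q + x) % q) = ∑ j ∈ Finset.range q, F p * G j := by
      refine Finset.sum_congr rfl fun j hj => ?_
      rw [Finset.mem_range] at hj
      have e1 : (p * q + j) / q = p := by rw [Nat.add_comm, Nat.add_mul_div_right _ _ hq, Nat.div_eq_of_lt hj, Nat.zero_add]
      have e2 : (p * q + j) % q = j := by rw [Nat.add_comm, Nat.add_mul_mod_self_right, Nat.mod_eq_of_lt hj]
      rw [e1, e2]
    rw [Nat.succ_mul, Finset.sum_range_add, ih, key, Finset.sum_range_succ, add_mul, ← Finset.mul_sum]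

/-! ## Kronecker stacked certificates -/

/-- the three 2-head classes (first block LA; second block LB over LZ) and two families of 2-head LU certificates indexed by a 2-shape
(position 3s₀+s₁): (rA, prA, pcA, tUA, tVA, twA) for the first-block core matrices A_{s′} (rows h′ ≤ s′, columns g′ ≤ 2 − s′, lexicographic), and
(rB, prB, pcB, tUB, tVB, twB) for the STACKED second-block matrices [B_{s″} ; Z_{s″}] (rows (layer, h″) layer-major): ranks, ordered pivot rows /
columns, left factors U, right factors V, norm cofactors of the V-pivots, all in ℤ[ζ₈]. -/
structure KronCert where
  LA : List (ℤ × ℕ × ℕ)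
  LB : List (ℤ × ℕ × ℕ)
  LZ : List (ℤ × ℕ × ℕ)
  rA : List ℕ
  prA : List (List (ℕ × ℕ))
  pcA : List (List (ℕ × ℕ))
  tUA : List (List (List Z8))
  tVA : List (List (List Z8))
  twA : List (List Z8)
  rB : List ℕ
  prB : List (List (ℕ × ℕ × ℕ))
  pcB : List (List (ℕ × ℕ))
  tUB : List (List (List Z8))
  tVB : List (List (List Z8))
  twB : List (List Z8)

namespace KronCert

variable (Ψ : KronCert)

/-- rank of the first-block matrix A_{s′}. -/
def rkA (s0 s1 : ℕ) : ℕ := lget 0 Ψ.rA (3 * s0 + s1)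
/-- its ℓ-th pivot row h′ … -/
def rowA (s0 s1 ℓ : ℕ) : ℕ × ℕ := lget (0, 0) (lget [] Ψ.prA (3 * s0 + s1)) ℓ
/-- … and pivot column g′. -/
def colA (s0 s1 ℓ : ℕ) : ℕ × ℕ := lget (0, 0) (lget [] Ψ.pcA (3 * s0 + s1)) ℓ
/-- U_{s′}[(a,b), ℓ]. -/
def UA (s0 s1 a b ℓ : ℕ) : Z8 := lget 0 (lget [] (lget [] Ψ.tUA (3 * s0 + s1)) (a * (s1 + 1) + b)) ℓ
/-- V_{s′}[ℓ, (a,b)]. -/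
def VA (s0 s1 ℓ a b : ℕ) : Z8 := lget 0 (lget [] (lget [] Ψ.tVA (3 * s0 + s1)) ℓ) (a * (3 - s1) + b)
/-- norm cofactor of the ℓ-th V_{s′}-pivot. -/
def wA (s0 s1 ℓ : ℕ) : Z8 := lget 0 (lget [] Ψ.twA (3 * s0 + s1)) ℓ
/-- rank of the stacked second-block matrix [B_{s″} ; Z_{s″}]. -/
def rkB (s2 s3 : ℕ) : ℕ := lget 0 Ψ.rB (3 * s2 + s3)
/-- its ℓ-th pivot row (layer, h″) … -/
def rowB (s2 s3 ℓ : ℕ) : ℕ × ℕ × ℕ := lget (0, 0, 0) (lget [] Ψ.prB (3 * s2 + s3)) ℓ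
/-- … and pivot column g″. -/
def colB (s2 s3 ℓ : ℕ) : ℕ × ℕ := lget (0, 0) (lget [] Ψ.pcB (3 * s2 + s3)) ℓ
/-- U_{s″}[(layer, c, d), ℓ]. -/
def UB (s2 s3 lay c d ℓ : ℕ) : Z8 := lget 0 (lget [] (lget [] Ψ.tUB (3 * s2 + s3)) (lay * ((s2 + 1) * (s3 + 1)) + c * (s3 + 1) + d)) ℓ
/-- V_{s″}[ℓ, (c,d)]. -/
def VB (s2 s3 ℓ c d : ℕ) : Z8 := lget 0 (lget [] (lget [] Ψ.tVB (3 * s2 + s3)) ℓ) (c * (3 - s3) + d)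
/-- norm cofactor of the ℓ-th V_{s″}-pivot. -/
def wB (s2 s3 ℓ : ℕ) : Z8 := lget 0 (lget [] Ψ.twB (3 * s2 + s3)) ℓ

/-! ### the expanded 4-head stacked certificate (Kronecker product; mode ℓ ↔ (ℓ / r_B, ℓ % r_B)) -/

/-- rank of the stacked 4-head block of shape s = (s′, s″): r_A(s′) · r_B(s″). -/
def rs (s0 s1 s2 s3 : ℕ) : ℕ := Ψ.rkA s0 s1 * Ψ.rkB s2 s3
/-- the ℓ-th pivot row (layer, a, b, c, d): layer and (c,d) from the second-block pivot ℓ % r_B, (a,b) from the first-block pivot ℓ / r_B … -/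
def rowP (s0 s1 s2 s3 ℓ : ℕ) : ℕ × ℕ × ℕ × ℕ × ℕ :=
  ((Ψ.rowB s2 s3 (ℓ % Ψ.rkB s2 s3)).1, (Ψ.rowA s0 s1 (ℓ / Ψ.rkB s2 s3)).1, (Ψ.rowA s0 s1 (ℓ / Ψ.rkB s2 s3)).2,
    (Ψ.rowB s2 s3 (ℓ % Ψ.rkB s2 s3)).2.1, (Ψ.rowB s2 s3 (ℓ % Ψ.rkB s2 s3)).2.2)
/-- … and pivot column (a, b, c, d). -/
def colP (s0 s1 s2 s3 ℓ : ℕ) : ℕ × ℕ × ℕ × ℕ :=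
  ((Ψ.colA s0 s1 (ℓ / Ψ.rkB s2 s3)).1, (Ψ.colA s0 s1 (ℓ / Ψ.rkB s2 s3)).2, (Ψ.colB s2 s3 (ℓ % Ψ.rkB s2 s3)).1,
    (Ψ.colB s2 s3 (ℓ % Ψ.rkB s2 s3)).2)
/-- A_s[(layer, a, b, c, d), ℓ] = U_{s′}[(a,b), ℓ / r_B] · U_{s″}[(layer, c, d), ℓ % r_B]. -/
def A (s0 s1 s2 s3 lay a b c d ℓ : ℕ) : Z8 := Ψ.UA s0 s1 a b (ℓ / Ψ.rkB s2 s3) * Ψ.UB s2 s3 lay c d (ℓ % Ψ.rkB s2 s3)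
/-- B_s[ℓ, (a, b, c, d)] = V_{s′}[ℓ / r_B, (a,b)] · V_{s″}[ℓ % r_B, (c,d)]. -/
def B (s0 s1 s2 s3 ℓ a b c d : ℕ) : Z8 := Ψ.VA s0 s1 (ℓ / Ψ.rkB s2 s3) a b * Ψ.VB s2 s3 (ℓ % Ψ.rkB s2 s3) c d
/-- norm cofactor of the ℓ-th B-pivot: the product of the two. -/
def w (s0 s1 s2 s3 ℓ : ℕ) : Z8 := Ψ.wA s0 s1 (ℓ / Ψ.rkB s2 s3) * Ψ.wB s2 s3 (ℓ % Ψ.rkB s2 s3)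

/-! ### validity (kernel-decided): class splitting + (F) (T) (P) of the small certificates -/

/-- (C) the 4-head cores split through the blocks: C¹(a,b,c,d) = A(a,b)·B(c,d), C²(a,b,c,d) = A(a,b)·Z(c,d) for all heads ≤ 2. -/
def validC (L1 L2 : List (ℤ × ℕ × ℕ × ℕ × ℕ)) : Bool :=
  Z8.allLT 2 fun lay => Z8.allLT 3 fun a => Z8.allLT 3 fun b => Z8.allLT 3 fun c => Z8.allLT 3 fun d =>
    decide (qcore (qlayer L1 L2 lay) a b c d = hcore Ψ.LA a b * hcore (hlayer Ψ.LB Ψ.LZ lay) c d)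
/-- (F_A) Σ_ℓ U_{s′}[h′, ℓ] V_{s′}[ℓ, g′] = A(h′+g′). -/
def validFA : Bool :=
  Z8.allLT 3 fun s0 => Z8.allLT 3 fun s1 => Z8.allLT (s0 + 1) fun a => Z8.allLT (s1 + 1) fun b => Z8.allLT (3 - s0) fun a' =>
    Z8.allLT (3 - s1) fun b' =>
      decide (Z8.rsum (Ψ.rkA s0 s1) (fun ℓ => Ψ.UA s0 s1 a b ℓ * Ψ.VA s0 s1 ℓ a' b') = hcore Ψ.LA (a + a') (b + b'))
/-- (F_B) Σ_ℓ U_{s″}[(layer, h″), ℓ] V_{s″}[ℓ, g″] = B(h″+g″) (layer 0), Z(h″+g″) (layer 1). -/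
def validFB : Bool :=
  Z8.allLT 3 fun s2 => Z8.allLT 3 fun s3 => Z8.allLT 2 fun lay => Z8.allLT (s2 + 1) fun c => Z8.allLT (s3 + 1) fun d =>
    Z8.allLT (3 - s2) fun c' => Z8.allLT (3 - s3) fun d' =>
      decide (Z8.rsum (Ψ.rkB s2 s3) (fun ℓ => Ψ.UB s2 s3 lay c d ℓ * Ψ.VB s2 s3 ℓ c' d') = hcore (hlayer Ψ.LB Ψ.LZ lay) (c + c') (d + d'))
/-- (T_A) triangularity of the first-block certificates on their pivots. -/
def validTA : Bool :=
  Z8.allLT 3 fun s0 => Z8.allLT 3 fun s1 => Z8.allLT (Ψ.rkA s0 s1) fun ℓ₀ => Z8.allLT (Ψ.rkA s0 s1) fun ℓ => decide (ℓ ≤ ℓ₀) ||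
    (decide (Ψ.UA s0 s1 (Ψ.rowA s0 s1 ℓ₀).1 (Ψ.rowA s0 s1 ℓ₀).2 ℓ = 0) && decide (Ψ.VA s0 s1 ℓ (Ψ.colA s0 s1 ℓ₀).1 (Ψ.colA s0 s1 ℓ₀).2 = 0))
/-- (T_B) triangularity of the stacked second-block certificates on their pivots. -/
def validTB : Bool :=
  Z8.allLT 3 fun s2 => Z8.allLT 3 fun s3 => Z8.allLT (Ψ.rkB s2 s3) fun ℓ₀ => Z8.allLT (Ψ.rkB s2 s3) fun ℓ => decide (ℓ ≤ ℓ₀) ||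
    (decide (Ψ.UB s2 s3 (Ψ.rowB s2 s3 ℓ₀).1 (Ψ.rowB s2 s3 ℓ₀).2.1 (Ψ.rowB s2 s3 ℓ₀).2.2 ℓ = 0) &&
      decide (Ψ.VB s2 s3 ℓ (Ψ.colB s2 s3 ℓ₀).1 (Ψ.colB s2 s3 ℓ₀).2 = 0))
/-- (P_A) pivots of the first-block certificates: positive-integer pivots inside the boxes. -/
def validPA : Bool :=
  Z8.allLT 3 fun s0 => Z8.allLT 3 fun s1 => Z8.allLT (Ψ.rkA s0 s1) fun ℓ =>
    (Ψ.UA s0 s1 (Ψ.rowA s0 s1 ℓ).1 (Ψ.rowA s0 s1 ℓ).2 ℓ).isPosConst && (Ψ.VA s0 s1 ℓ (Ψ.colA s0 s1 ℓ).1 (Ψ.colA s0 s1 ℓ).2 * Ψ.wA s0 s1 ℓ).isPosConst &&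
    decide ((Ψ.rowA s0 s1 ℓ).1 ≤ s0 ∧ (Ψ.rowA s0 s1 ℓ).2 ≤ s1 ∧ (Ψ.colA s0 s1 ℓ).1 ≤ 2 - s0 ∧ (Ψ.colA s0 s1 ℓ).2 ≤ 2 - s1)
/-- (P_B) pivots of the stacked second-block certificates: positive-integer pivots inside the layers and boxes. -/
def validPB : Bool :=
  Z8.allLT 3 fun s2 => Z8.allLT 3 fun s3 => Z8.allLT (Ψ.rkB s2 s3) fun ℓ =>
    (Ψ.UB s2 s3 (Ψ.rowB s2 s3 ℓ).1 (Ψ.rowB s2 s3 ℓ).2.1 (Ψ.rowB s2 s3 ℓ).2.2 ℓ).isPosConst &&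
    (Ψ.VB s2 s3 ℓ (Ψ.colB s2 s3 ℓ).1 (Ψ.colB s2 s3 ℓ).2 * Ψ.wB s2 s3 ℓ).isPosConst &&
    decide ((Ψ.rowB s2 s3 ℓ).1 ≤ 1 ∧ (Ψ.rowB s2 s3 ℓ).2.1 ≤ s2 ∧ (Ψ.rowB s2 s3 ℓ).2.2 ≤ s3 ∧ (Ψ.colB s2 s3 ℓ).1 ≤ 2 - s2 ∧
      (Ψ.colB s2 s3 ℓ).2 ≤ 2 - s3)
/-- VALIDITY of a Kronecker stacked certificate for the pair of 4-twist classes (L1 ; L2). -/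
def valid (L1 L2 : List (ℤ × ℕ × ℕ × ℕ × ℕ)) : Bool :=
  Ψ.validC L1 L2 && Ψ.validFA && Ψ.validFB && Ψ.validTA && Ψ.validTB && Ψ.validPA && Ψ.validPB

variable {Ψ} {L1 L2 : List (ℤ × ℕ × ℕ × ℕ × ℕ)}

/-- the seven conjuncts of validity. -/
theorem valid_parts (h : Ψ.valid L1 L2 = true) : Ψ.validC L1 L2 = true ∧ Ψ.validFA = true ∧ Ψ.validFB = true ∧ Ψ.validTA = true ∧
    Ψ.validTB = true ∧ Ψ.validPA = true ∧ Ψ.validPB = true := by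
  simp only [valid, Bool.and_eq_true] at h
  obtain ⟨⟨⟨⟨⟨⟨hC, hFA⟩, hFB⟩, hTA⟩, hTB⟩, hPA⟩, hPB⟩ := h
  exact ⟨hC, hFA, hFB, hTA, hTB, hPA, hPB⟩

/-- r_B > 0 and the two mode components are in range, for a mode ℓ < r_A · r_B. -/
theorem divMod_lt {s0 s1 s2 s3 ℓ : ℕ} (hℓ : ℓ < Ψ.rs s0 s1 s2 s3) :
    0 < Ψ.rkB s2 s3 ∧ ℓ / Ψ.rkB s2 s3 < Ψ.rkA s0 s1 ∧ ℓ % Ψ.rkB s2 s3 < Ψ.rkB s2 s3 := by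
  unfold rs at hℓ
  have hB : 0 < Ψ.rkB s2 s3 := Nat.pos_of_ne_zero fun h => by simp [h] at hℓ
  exact ⟨hB, (Nat.div_lt_iff_lt_mul hB).mpr hℓ, Nat.mod_lt _ hB⟩

variable {K : Type*} [Field K] (ζ : K)

/-- soundness of (F), EVALUATED: Σ_{ℓ<r_s} A_s[(layer, h), ℓ](ζ) · B_s[ℓ, g](ζ) = C^{layer}(h+g)(ζ) for the expanded certificate. -/
theorem factor_eq_eval (h4 : ζ ^ 4 = -1) (h : Ψ.valid L1 L2 = true) {s0 s1 s2 s3 lay a b c d a' b' c' d' : ℕ} (h0 : s0 < 3) (h1 : s1 < 3)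
    (h2 : s2 < 3) (h3 : s3 < 3) (hl : lay < 2) (ha : a < s0 + 1) (hb : b < s1 + 1) (hc : c < s2 + 1) (hd : d < s3 + 1) (ha' : a' < 3 - s0)
    (hb' : b' < 3 - s1) (hc' : c' < 3 - s2) (hd' : d' < 3 - s3) :
    ∑ ℓ ∈ Finset.range (Ψ.rs s0 s1 s2 s3), Z8.eval ζ (Ψ.A s0 s1 s2 s3 lay a b c d ℓ) * Z8.eval ζ (Ψ.B s0 s1 s2 s3 ℓ a' b' c' d') =
      Z8.eval ζ (qcore (qlayer L1 L2 lay) (a + a') (b + b') (c + c') (d + d')) := by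
  obtain ⟨hC, hFA, hFB, -, -, -, -⟩ := valid_parts h
  simp only [validC, Z8.allLT_iff, decide_eq_true_eq] at hC
  simp only [validFA, Z8.allLT_iff, decide_eq_true_eq] at hFA
  simp only [validFB, Z8.allLT_iff, decide_eq_true_eq] at hFB
  rw [hC lay hl (a + a') (by omega) (b + b') (by omega) (c + c') (by omega) (d + d') (by omega), Z8.eval_mul ζ h4,
    ← hFA s0 h0 s1 h1 a ha b hb a' ha' b' hb', ← hFB s2 h2 s3 h3 lay hl c hc d hd c' hc' d' hd', Z8.eval_rsum, Z8.eval_rsum, rs,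
    ← sum_range_mul_divMod (Ψ.rkA s0 s1) (Ψ.rkB s2 s3) (fun i => Z8.eval ζ (Ψ.UA s0 s1 a b i * Ψ.VA s0 s1 i a' b'))
      (fun j => Z8.eval ζ (Ψ.UB s2 s3 lay c d j * Ψ.VB s2 s3 j c' d'))]
  refine Finset.sum_congr rfl fun ℓ _ => ?_
  simp only [A, B, Z8.eval_mul ζ h4]
  ring

/-- soundness of (T), A part: the expanded left factor vanishes above the (lexicographically paired) pivots. -/
theorem A_upper_zero (h : Ψ.valid L1 L2 = true) {s0 s1 s2 s3 ℓ₀ ℓ : ℕ} (h0 : s0 < 3) (h1 : s1 < 3) (h2 : s2 < 3) (h3 : s3 < 3)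
    (hℓ₀ : ℓ₀ < Ψ.rs s0 s1 s2 s3) (hℓ : ℓ < Ψ.rs s0 s1 s2 s3) (hlt : ℓ₀ < ℓ) :
    Ψ.A s0 s1 s2 s3 (Ψ.rowP s0 s1 s2 s3 ℓ₀).1 (Ψ.rowP s0 s1 s2 s3 ℓ₀).2.1 (Ψ.rowP s0 s1 s2 s3 ℓ₀).2.2.1 (Ψ.rowP s0 s1 s2 s3 ℓ₀).2.2.2.1
      (Ψ.rowP s0 s1 s2 s3 ℓ₀).2.2.2.2 ℓ = 0 := by
  obtain ⟨-, -, -, hTA, hTB, -, -⟩ := valid_parts h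
  simp only [validTA, Z8.allLT_iff, Bool.or_eq_true, Bool.and_eq_true, decide_eq_true_eq] at hTA
  simp only [validTB, Z8.allLT_iff, Bool.or_eq_true, Bool.and_eq_true, decide_eq_true_eq] at hTB
  obtain ⟨hBpos, hq₀, hm₀⟩ := divMod_lt hℓ₀
  obtain ⟨-, hq, hm⟩ := divMod_lt hℓ
  have hle : ℓ₀ / Ψ.rkB s2 s3 ≤ ℓ / Ψ.rkB s2 s3 := Nat.div_le_div_right hlt.le
  unfold A rowP
  rcases hle.lt_or_eq with hqlt | hqeq
  · rcases hTA s0 h0 s1 h1 _ hq₀ _ hq with hbad | ⟨hU, -⟩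
    · omega
    · rw [hU, Z8.zero_mul']
  · have hmlt : ℓ₀ % Ψ.rkB s2 s3 < ℓ % Ψ.rkB s2 s3 := by
      have e₀ := Nat.div_add_mod ℓ₀ (Ψ.rkB s2 s3)
      have e := Nat.div_add_mod ℓ (Ψ.rkB s2 s3)
      rw [hqeq] at e₀
      omega
    rcases hTB s2 h2 s3 h3 _ hm₀ _ hm with hbad | ⟨hU, -⟩
    · omega
    · rw [hqeq, hU, Z8.mul_zero']

/-- soundness of (T), B part. -/
theorem B_lower_zero (h : Ψ.valid L1 L2 = true) {s0 s1 s2 s3 ℓ₀ ℓ : ℕ} (h0 : s0 < 3) (h1 : s1 < 3) (h2 : s2 < 3) (h3 : s3 < 3)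
    (hℓ₀ : ℓ₀ < Ψ.rs s0 s1 s2 s3) (hℓ : ℓ < Ψ.rs s0 s1 s2 s3) (hlt : ℓ₀ < ℓ) :
    Ψ.B s0 s1 s2 s3 ℓ (Ψ.colP s0 s1 s2 s3 ℓ₀).1 (Ψ.colP s0 s1 s2 s3 ℓ₀).2.1 (Ψ.colP s0 s1 s2 s3 ℓ₀).2.2.1 (Ψ.colP s0 s1 s2 s3 ℓ₀).2.2.2 = 0 := by
  obtain ⟨-, -, -, hTA, hTB, -, -⟩ := valid_parts h
  simp only [validTA, Z8.allLT_iff, Bool.or_eq_true, Bool.and_eq_true, decide_eq_true_eq] at hTA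
  simp only [validTB, Z8.allLT_iff, Bool.or_eq_true, Bool.and_eq_true, decide_eq_true_eq] at hTB
  obtain ⟨hBpos, hq₀, hm₀⟩ := divMod_lt hℓ₀
  obtain ⟨-, hq, hm⟩ := divMod_lt hℓ
  have hle : ℓ₀ / Ψ.rkB s2 s3 ≤ ℓ / Ψ.rkB s2 s3 := Nat.div_le_div_right hlt.le
  unfold B colP
  rcases hle.lt_or_eq with hqlt | hqeq
  · rcases hTA s0 h0 s1 h1 _ hq₀ _ hq with hbad | ⟨-, hV⟩
    · omega
    · rw [hV, Z8.zero_mul']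
  · have hmlt : ℓ₀ % Ψ.rkB s2 s3 < ℓ % Ψ.rkB s2 s3 := by
      have e₀ := Nat.div_add_mod ℓ₀ (Ψ.rkB s2 s3)
      have e := Nat.div_add_mod ℓ (Ψ.rkB s2 s3)
      rw [hqeq] at e₀
      omega
    rcases hTB s2 h2 s3 h3 _ hm₀ _ hm with hbad | ⟨-, hV⟩
    · omega
    · rw [hqeq, hV, Z8.mul_zero']

/-- soundness of (P): the expanded pivots are positive integers (products of such) inside their layers and boxes. -/
theorem pivots (h : Ψ.valid L1 L2 = true) {s0 s1 s2 s3 ℓ : ℕ} (h0 : s0 < 3) (h1 : s1 < 3) (h2 : s2 < 3) (h3 : s3 < 3)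
    (hℓ : ℓ < Ψ.rs s0 s1 s2 s3) :
    (Ψ.A s0 s1 s2 s3 (Ψ.rowP s0 s1 s2 s3 ℓ).1 (Ψ.rowP s0 s1 s2 s3 ℓ).2.1 (Ψ.rowP s0 s1 s2 s3 ℓ).2.2.1 (Ψ.rowP s0 s1 s2 s3 ℓ).2.2.2.1
      (Ψ.rowP s0 s1 s2 s3 ℓ).2.2.2.2 ℓ).isPosConst = true ∧
    (Ψ.B s0 s1 s2 s3 ℓ (Ψ.colP s0 s1 s2 s3 ℓ).1 (Ψ.colP s0 s1 s2 s3 ℓ).2.1 (Ψ.colP s0 s1 s2 s3 ℓ).2.2.1 (Ψ.colP s0 s1 s2 s3 ℓ).2.2.2 *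
      Ψ.w s0 s1 s2 s3 ℓ).isPosConst = true ∧
    ((Ψ.rowP s0 s1 s2 s3 ℓ).1 ≤ 1 ∧ (Ψ.rowP s0 s1 s2 s3 ℓ).2.1 ≤ s0 ∧ (Ψ.rowP s0 s1 s2 s3 ℓ).2.2.1 ≤ s1 ∧
      (Ψ.rowP s0 s1 s2 s3 ℓ).2.2.2.1 ≤ s2 ∧ (Ψ.rowP s0 s1 s2 s3 ℓ).2.2.2.2 ≤ s3 ∧
      (Ψ.colP s0 s1 s2 s3 ℓ).1 ≤ 2 - s0 ∧ (Ψ.colP s0 s1 s2 s3 ℓ).2.1 ≤ 2 - s1 ∧ (Ψ.colP s0 s1 s2 s3 ℓ).2.2.1 ≤ 2 - s2 ∧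
      (Ψ.colP s0 s1 s2 s3 ℓ).2.2.2 ≤ 2 - s3) := by
  obtain ⟨-, -, -, -, -, hPA, hPB⟩ := valid_parts h
  simp only [validPA, Z8.allLT_iff, Bool.and_eq_true, decide_eq_true_eq] at hPA
  simp only [validPB, Z8.allLT_iff, Bool.and_eq_true, decide_eq_true_eq] at hPB
  obtain ⟨hBpos, hq, hm⟩ := divMod_lt hℓ
  obtain ⟨⟨hUA, hVA⟩, hboxA⟩ := hPA s0 h0 s1 h1 _ hq
  obtain ⟨⟨hUB, hVB⟩, hboxB⟩ := hPB s2 h2 s3 h3 _ hm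
  unfold A B w rowP colP
  refine ⟨Z8.isPosConst_mul hUA hUB, ?_, hboxB.1, hboxA.1, hboxA.2.1, hboxB.2.1, hboxB.2.2.1, hboxA.2.2.1, hboxA.2.2.2, hboxB.2.2.2.1,
    hboxB.2.2.2.2⟩
  rw [Z8.mul_mul_mul_comm']
  exact Z8.isPosConst_mul hVA hVB

end KronCert

/-- r_{shape k} of a Kronecker stacked certificate for a type k of the sixfold (heads = all four pairs) … -/
abbrev krs6 (Ψ : KronCert) (k : Fin 19) : ℕ := Ψ.rs (PlaneRank6.sig0 k) (PlaneRank6.sig1 k) (PlaneRank6.sig2 k) (PlaneRank6.sig3 k)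
/-- … and of the eightfold (heads = the first four pairs, tail = pair 4). -/
abbrev krs8 (Ψ : KronCert) (k : Fin 45) : ℕ := Ψ.rs (PlaneRank8.sig0 k) (PlaneRank8.sig1 k) (PlaneRank8.sig2 k) (PlaneRank8.sig3 k)

end Summit.HodgeConjecture.HodgeConjecture.HodgeLocus.Census.PlaneSum
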